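import Summits.ResolutionOfSingularities.ResolutionOfSingularities.Theorems.PAlterationAssembly2FunctionField
import HarnessLib

/-!
# WildQuotients / `GaloisQuotientAlteration` (stmt-ResolutionOfSingularities-16323) — helper:
# generically finite morphisms with purely inseparable function field extension are radicial
# over a dense open (EGA I, 3.5.8; Stacks 01S2–01S4)

Helper file (`--supports stmt-ResolutionOfSingularities-16323`): the "`φ : X₁/G → X` finite
and universally injective over a dense open" clause of the route decl
`WildQuotients.GaloisQuotientAlteration`, from de Jong's condition (d) on function fields.

Let `φ : Q → X` be a dominant morphism of integral schemes, finite over an affine open `V`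
containing the generic point `ξ` of `X`, and suppose the function field extension
`K(X) ⊂ K(Q)` (`Literature.AlgebraicGeometry.Motives.RatFn.functionFieldMap`) is PURELY
INSEPARABLE in characteristic `p`: every `b ∈ K(Q)` has `b^{pⁿ} ∈ φ♯ K(X)` for some `n`.
Then `φ` is UNIVERSALLY INJECTIVE (radicial) over the basic open `X_s ⊆ V` of a suitable
`0 ≠ s ∈ Γ(X, V)` (`exists_universallyInjective_morphismRestrict_of_forall_pow_mem`): with
`A = Γ(X, V)`, `B = Γ(Q, φ⁻¹V)` finite over `A`, each generator `bᵢ` of `B` satisfies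
`sᵢ bᵢ^{p^{nᵢ}} = aᵢ` for some `aᵢ, sᵢ ∈ A`, `sᵢ ≠ 0` (`K(X) = Frac A`); for `s = ∏ sᵢ` every
`b ∈ B` then has some `s^k b^{pⁿ} ∈ A` (a predicate stable under sums, products and
`A`-multiples, checked on the `bᵢ`), so that over `A_s → B_s` every element has a `pⁿ`-th power in the base, which makes
`Spec B_s → Spec A_s` injective on field-valued points
(`universallyInjective_SpecMap_of_forall_pow_mem`: Frobenius is injective on fields).

This is the scheme-theoretic form of "`k(Q)/k(X)` purely inseparable ⇔ `φ` radicial over a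
dense open" for generically finite dominant morphisms (EGA I, 3.5.8: radicial ⟺ injective with
purely inseparable residue field extensions; cf. the rendering note of
`IsPurelyInseparableAlteration` in `Literature.AlgebraicGeometry.Resolution.Alterations`). Also
recorded: a fibre over a point of an open over which a morphism is finite is finite
(`finite_preimage_singleton_of_isFinite_morphismRestrict`). The affine transport lemmas
(`morphismRestrict_iff_specMap_app`, …) are those of `PAlterationAssembly2FunctionField`.

Everything is proved; no named facts are used.

## References

* A. Grothendieck, J. Dieudonné, *EGA I* (1971), 3.5.4–3.5.8 (radicial morphisms).
* The Stacks project, Tags 01S2, 01S3, 01S4 (universally injective = radicial). [StacksProject]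
-/

noncomputable section

universe u

open CategoryTheory Limits AlgebraicGeometry TopologicalSpace Opposite
open Literature.AlgebraicGeometry.Motives Literature.AlgebraicGeometry.Motives.RatFn

set_option linter.dupNamespace false -- mandated namespace of this single-conjunct summit

namespace Summit.ResolutionOfSingularities.ResolutionOfSingularities.Theorems

/-! ### Radicial ring maps -/

/-- **Radicial ring maps.** Let `φ : R → S` be a ring map with `char R = p` prime such that some
`pⁿ`-th power of every element of `S` lies in the image of `φ`. Then `Spec S → Spec R` is
universally injective: two `K`-points `ψ₁, ψ₂ : S → K` (`K` a field) agreeing on `φ(R)` satisfy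
`ψ₁(b)^{pⁿ} = ψ₂(b)^{pⁿ}`, and the iterated Frobenius of `K` is injective (Stacks 01S2–01S4).
[folklore] -/
theorem universallyInjective_SpecMap_of_forall_pow_mem {R S : CommRingCat.{u}} (φ : R ⟶ S)
    {p : ℕ} (hp : p.Prime) [CharP R p] (h : ∀ b : S, ∃ (n : ℕ) (a : R), b ^ p ^ n = φ a) :
    UniversallyInjective (Spec.map φ) := by
  refine ((tfae_universallyInjective (Spec.map φ)).out 0 1).mpr ?_
  intro K _ a₁ a₂ h12
  obtain ⟨ψ₁, rfl⟩ := Spec.map_surjective a₁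
  obtain ⟨ψ₂, rfl⟩ := Spec.map_surjective a₂
  have h12' : Spec.map (φ ≫ ψ₁) = Spec.map (φ ≫ ψ₂) := by
    simpa only [Spec.map_comp] using h12
  have hφψ : φ ≫ ψ₁ = φ ≫ ψ₂ := Spec.map_injective h12'
  -- `K` has characteristic `p`: it receives the ring map `ψ₁ ∘ φ` from `R`
  haveI : CharP K p := by
    rw [CharP.charP_iff_prime_eq_zero hp]
    rw [← map_natCast (φ ≫ ψ₁).hom p, CharP.cast_eq_zero, map_zero]
  haveI : ExpChar K p := ExpChar.prime hp
  congr 1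
  ext b
  obtain ⟨n, a, ha⟩ := h b
  apply iterateFrobenius_inj K p n
  rw [iterateFrobenius_def, iterateFrobenius_def]
  change (ψ₁.hom b) ^ p ^ n = (ψ₂.hom b) ^ p ^ n
  rw [← map_pow, ← map_pow, ha]
  exact congr(($hφψ).hom a)

/-! ### The predicate "some `s^k b^{pⁿ}` comes from the base" -/

section PowMem

variable {A B : Type*} [CommRing A] [CommRing B] [Algebra A B] {p : ℕ} {s : A}

/-- Raising the exponent: if `(n, k, a)` witnesses `s^k b^{pⁿ} ∈ A` then there is a witness with
any larger exponent. [folklore] -/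
theorem exists_pow_mul_pow_eq_of_le {b : B}
    (hb : ∃ (n k : ℕ) (a : A), algebraMap A B s ^ k * b ^ p ^ n = algebraMap A B a) (m : ℕ) :
    ∃ (n k : ℕ) (a : A), m ≤ n ∧ algebraMap A B s ^ k * b ^ p ^ n = algebraMap A B a := by
  obtain ⟨n, k, a, h⟩ := hb
  refine ⟨n + m, k * p ^ m, a ^ p ^ m, Nat.le_add_left m n, ?_⟩
  rw [pow_add, pow_mul, pow_mul, ← mul_pow, h, map_pow]

/-- Elements of the base have `s^0 a^{p^0} ∈ A`. [folklore] -/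
theorem exists_pow_mul_pow_eq_algebraMap (a : A) :
    ∃ (n k : ℕ) (a' : A), algebraMap A B s ^ k * algebraMap A B a ^ p ^ n = algebraMap A B a' :=
  ⟨0, 0, a, by simp⟩

/-- The predicate is closed under addition (Frobenius is additive in exponential characteristic
`p`). [folklore] -/
theorem exists_pow_mul_pow_eq_add [ExpChar B p] {b c : B}
    (hb : ∃ (n k : ℕ) (a : A), algebraMap A B s ^ k * b ^ p ^ n = algebraMap A B a)
    (hc : ∃ (n k : ℕ) (a : A), algebraMap A B s ^ k * c ^ p ^ n = algebraMap A B a) :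
    ∃ (n k : ℕ) (a : A), algebraMap A B s ^ k * (b + c) ^ p ^ n = algebraMap A B a := by
  obtain ⟨n₁, k₁, a₁, h₁⟩ := hb
  obtain ⟨n, k₂, a₂, hn₁, h₂⟩ := exists_pow_mul_pow_eq_of_le hc n₁
  obtain ⟨d, rfl⟩ := Nat.exists_eq_add_of_le hn₁
  have h₁' : algebraMap A B s ^ (k₁ * p ^ d) * b ^ p ^ (n₁ + d) = algebraMap A B (a₁ ^ p ^ d) := by
    rw [pow_add, pow_mul, pow_mul, ← mul_pow, h₁, map_pow]
  refine ⟨n₁ + d, k₁ * p ^ d + k₂, a₁ ^ p ^ d * s ^ k₂ + a₂ * s ^ (k₁ * p ^ d), ?_⟩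
  rw [add_pow_expChar_pow, mul_add, map_add, map_mul, map_mul, ← h₁', ← h₂, map_pow, map_pow]
  ring

/-- The predicate is closed under multiplication. [folklore] -/
theorem exists_pow_mul_pow_eq_mul {b c : B}
    (hb : ∃ (n k : ℕ) (a : A), algebraMap A B s ^ k * b ^ p ^ n = algebraMap A B a)
    (hc : ∃ (n k : ℕ) (a : A), algebraMap A B s ^ k * c ^ p ^ n = algebraMap A B a) :
    ∃ (n k : ℕ) (a : A), algebraMap A B s ^ k * (b * c) ^ p ^ n = algebraMap A B a := by
  obtain ⟨n₁, k₁, a₁, h₁⟩ := hb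
  obtain ⟨n, k₂, a₂, hn₁, h₂⟩ := exists_pow_mul_pow_eq_of_le hc n₁
  obtain ⟨d, rfl⟩ := Nat.exists_eq_add_of_le hn₁
  have h₁' : algebraMap A B s ^ (k₁ * p ^ d) * b ^ p ^ (n₁ + d) = algebraMap A B (a₁ ^ p ^ d) := by
    rw [pow_add, pow_mul, pow_mul, ← mul_pow, h₁, map_pow]
  refine ⟨n₁ + d, k₁ * p ^ d + k₂, a₁ ^ p ^ d * a₂, ?_⟩
  rw [mul_pow, map_mul, ← h₁', ← h₂, pow_add]
  ring

/-- **If the generators of `B` as an `A`-module satisfy the predicate then every element does.**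
[folklore] -/
theorem forall_exists_pow_mul_pow_eq_of_span [ExpChar B p] {ι : Type*} (g : ι → B)
    (hg : Submodule.span A (Set.range g) = ⊤)
    (h : ∀ i, ∃ (n k : ℕ) (a : A), algebraMap A B s ^ k * g i ^ p ^ n = algebraMap A B a)
    (b : B) : ∃ (n k : ℕ) (a : A), algebraMap A B s ^ k * b ^ p ^ n = algebraMap A B a := by
  have hb : b ∈ Submodule.span A (Set.range g) := by rw [hg]; exact Submodule.mem_top
  induction hb using Submodule.span_induction with
  | mem x hx => obtain ⟨i, rfl⟩ := hx; exact h i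
  | zero => simpa using exists_pow_mul_pow_eq_algebraMap (p := p) (s := s) (B := B) (0 : A)
  | add x y _ _ hx hy => exact exists_pow_mul_pow_eq_add hx hy
  | smul a x _ hx =>
    rw [Algebra.smul_def]
    exact exists_pow_mul_pow_eq_mul (exists_pow_mul_pow_eq_algebraMap a) hx

end PowMem

/-! ### Fibres of a morphism finite over an open -/

section Transport

variable {X Y : Scheme.{u}} (f : X ⟶ Y) {U : Y.Opens}

/-- **A fibre over a point of an open over which `f` is finite is finite.** [folklore] -/
theorem finite_preimage_singleton_of_isFinite_morphismRestrict (U : Y.Opens) [IsFinite (f ∣_ U)]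
    {y : Y} (hy : y ∈ U) : (f ⁻¹' {y}).Finite := by
  have h := (f ∣_ U).finite_preimage_singleton ⟨y, hy⟩
  have himg : f ⁻¹' {y} = (f ⁻¹ᵁ U).ι '' ((f ∣_ U) ⁻¹' {⟨y, hy⟩}) := by
    ext x
    constructor
    · intro hx
      have hxU : x ∈ f ⁻¹ᵁ U := by
        change f x ∈ U
        rw [show f x = y from hx]; exact hy
      refine ⟨⟨x, hxU⟩, ?_, rfl⟩
      apply Subtype.ext
      change ((f ∣_ U) ⟨x, hxU⟩).1 = y
      rw [morphismRestrict_base_coe]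
      exact hx
    · rintro ⟨x, hx, rfl⟩
      change f ((f ⁻¹ᵁ U).ι x) = y
      have := congrArg Subtype.val hx
      rw [morphismRestrict_base_coe] at this
      exact this
  rw [himg]
  exact h.image _

end Transport

/-! ### Purely inseparable function field extension ⇒ radicial over a dense open -/

section Radicial

variable {Q X : Scheme.{u}} [IsIntegral Q] [IsIntegral X] (φ : Q ⟶ X) [IsDominant φ]

/-- The generic point of `Q` lies over every open containing the generic point of `X`.
[folklore] -/
theorem genericPoint_mem_preimage {V : X.Opens} (hV : genericPoint X ∈ V) :
    genericPoint Q ∈ φ ⁻¹ᵁ V := by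
  change φ (genericPoint Q) ∈ V
  rw [genericPoint_eq_of_isDominant φ]
  exact hV

/-- **`φ♯` and pulled-back sections**: the germ at the generic point of `φ^*(a)` is `φ♯` of the
germ of `a` (Görtz–Wedhorn I, (11.16)). [folklore] -/
theorem germ_app_eq_functionFieldMap {V : X.Opens} (hV : genericPoint X ∈ V) (a : Γ(X, V)) :
    Q.presheaf.germ (φ ⁻¹ᵁ V) (genericPoint Q) (genericPoint_mem_preimage φ hV) (φ.app V a) =
      functionFieldMap φ (X.presheaf.germ V (genericPoint X) hV a) := by
  have h1 : φ (genericPoint Q) ∈ V := genericPoint_mem_preimage φ hV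
  have e1 : X.presheaf.germ V (genericPoint X) hV a =
      toFunctionField (φ (genericPoint Q)) (X.presheaf.germ V _ h1 a) := by
    simp only [toFunctionField, RingHom.algebraMap_toAlgebra]
    exact (TopCat.Presheaf.germ_stalkSpecializes_apply X.presheaf _ _ a).symm
  rw [e1, functionFieldMap_toFunctionField, Scheme.Hom.germ_stalkMap_apply]
  simp only [toFunctionField, RingHom.algebraMap_toAlgebra]
  exact (TopCat.Presheaf.germ_stalkSpecializes_apply Q.presheaf _ _ _).symm

/-- **Step 1 (over `V`)**: if `φ` is finite over the affine open `V ∋ ξ` and `K(Q)/K(X)` is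
purely inseparable in characteristic `p`, there is `0 ≠ s ∈ Γ(X, V)` such that every
`b ∈ Γ(Q, φ⁻¹V)` has some `s^k b^{pⁿ}` in the image of `Γ(X, V)` (clear the denominators of
`b_i^{p^{n_i}} ∈ K(X) = Frac Γ(X, V)` for finitely many module generators `b_i`). [folklore] -/
theorem exists_forall_pow_mul_pow_eq {p : ℕ} (hp : p.Prime) [CharP X.functionField p]
    {V : X.Opens} (hV : IsAffineOpen V) (hξ : genericPoint X ∈ V) [IsFinite (φ ∣_ V)]
    (hpi : ∀ b : Q.functionField, ∃ (n : ℕ) (c : X.functionField),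
      b ^ p ^ n = functionFieldMap φ c) :
    ∃ s : Γ(X, V), s ≠ 0 ∧ ∀ b : Γ(Q, φ ⁻¹ᵁ V), ∃ (n k : ℕ) (a : Γ(X, V)),
      φ.app V s ^ k * b ^ p ^ n = φ.app V a := by
  classical
  have hξ' : genericPoint Q ∈ φ ⁻¹ᵁ V := genericPoint_mem_preimage φ hξ
  haveI : Nonempty V := ⟨⟨_, hξ⟩⟩
  haveI : Nonempty (φ ⁻¹ᵁ V) := ⟨⟨_, hξ'⟩⟩
  have hW : IsAffineOpen (φ ⁻¹ᵁ V) := isAffineOpen_preimage_of_isAffineHom_morphismRestrict φ hV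
  -- the rings `A = Γ(X, V) ⊆ K(X)`, `B = Γ(Q, φ⁻¹V) ⊆ K(Q)`
  letI algAB : Algebra Γ(X, V) Γ(Q, φ ⁻¹ᵁ V) := (φ.app V).hom.toAlgebra
  haveI : IsFractionRing Γ(X, V) X.functionField :=
    functionField_isFractionRing_of_isAffineOpen X V hV
  have hfin : Module.Finite Γ(X, V) Γ(Q, φ ⁻¹ᵁ V) := by
    have h := (morphismRestrict_iff_specMap_app φ hV hW (P := @IsFinite)).mp inferInstance
    exact (IsFinite.SpecMap_iff _).mp h
  -- characteristic `p` everywhere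
  haveI : CharP Q.functionField p :=
    ((functionFieldMap φ).charP_iff (functionFieldMap φ).injective p).mp inferInstance
  haveI : CharP Γ(Q, φ ⁻¹ᵁ V) p :=
    RingHom.charP (Q.germToFunctionField (φ ⁻¹ᵁ V)).hom
      (Q.germToFunctionField_injective _) p
  haveI : ExpChar Γ(Q, φ ⁻¹ᵁ V) p := ExpChar.prime hp
  -- injectivity of `B → K(Q)` and the compatibility `φ♯ ∘ germ = germ ∘ φ^*`
  have hinj : Function.Injective (Q.presheaf.germ (φ ⁻¹ᵁ V) (genericPoint Q) hξ') :=
    germ_injective_of_isIntegral Q _ hξ'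
  have hcompat : ∀ a : Γ(X, V), Q.presheaf.germ (φ ⁻¹ᵁ V) (genericPoint Q) hξ' (φ.app V a) =
      functionFieldMap φ (algebraMap Γ(X, V) X.functionField a) := fun a =>
    germ_app_eq_functionFieldMap φ hξ a
  -- generators and their denominators
  obtain ⟨m, g, hg⟩ := Module.Finite.exists_fin (R := Γ(X, V)) (M := Γ(Q, φ ⁻¹ᵁ V))
  have hgen : ∀ i : Fin m, ∃ (n : ℕ) (a t : Γ(X, V)), t ≠ 0 ∧
      φ.app V t * g i ^ p ^ n = φ.app V a := by
    intro i
    obtain ⟨n, c, hc⟩ := hpi (Q.presheaf.germ (φ ⁻¹ᵁ V) (genericPoint Q) hξ' (g i))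
    obtain ⟨a, t, ht, rfl⟩ := IsFractionRing.div_surjective (A := Γ(X, V)) c
    have ht0 : t ≠ 0 := nonZeroDivisors.ne_zero ht
    have ht0' : algebraMap Γ(X, V) X.functionField t ≠ 0 :=
      IsFractionRing.to_map_ne_zero_of_mem_nonZeroDivisors ht
    refine ⟨n, a, t, ht0, hinj ?_⟩
    rw [map_mul, map_pow, hc, hcompat, hcompat, ← map_mul, mul_div_cancel₀ _ ht0']
  choose n a t ht0 hrel using hgen
  refine ⟨∏ i, t i, Finset.prod_ne_zero_iff.mpr fun i _ => ht0 i, ?_⟩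
  -- every generator, hence every element, satisfies `PowMem`
  have hPow : ∀ i, ∃ (n' k : ℕ) (a' : Γ(X, V)), algebraMap _ Γ(Q, φ ⁻¹ᵁ V) (∏ j, t j) ^ k *
      g i ^ p ^ n' = algebraMap _ _ a' := by
    intro i
    refine ⟨n i, 1, (∏ j ∈ Finset.univ.erase i, t j) * a i, ?_⟩
    rw [pow_one, RingHom.algebraMap_toAlgebra, ← Finset.mul_prod_erase Finset.univ t
      (Finset.mem_univ i), map_mul, map_mul, mul_comm ((φ.app V) (t i)), mul_assoc, hrel i]
  intro b
  obtain ⟨n', k, a', h⟩ := forall_exists_pow_mul_pow_eq_of_span g hg hPow b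
  exact ⟨n', k, a', h⟩

/-- **Purely inseparable function field extension ⇒ radicial over a dense open** (EGA I, 3.5.8;
Stacks 01S4): for a dominant `φ : Q → X` of integral schemes, finite over the affine open
`V ∋ ξ`, with `K(Q)/K(X)` purely inseparable in characteristic `p`, there is `0 ≠ s ∈ Γ(X, V)`
such that `φ` is universally injective over the basic open `X_s` (which contains the generic
point). [cite: StacksProject, Tag 01S4 (with EGA I 3.5.8)] -/
theorem exists_universallyInjective_morphismRestrict_basicOpen {p : ℕ} (hp : p.Prime)
    [CharP X.functionField p] {V : X.Opens} (hV : IsAffineOpen V) (hξ : genericPoint X ∈ V)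
    [IsFinite (φ ∣_ V)]
    (hpi : ∀ b : Q.functionField, ∃ (n : ℕ) (c : X.functionField),
      b ^ p ^ n = functionFieldMap φ c) :
    ∃ s : Γ(X, V), s ≠ 0 ∧ UniversallyInjective (φ ∣_ X.basicOpen s) := by
  obtain ⟨s, hs0, hs⟩ := exists_forall_pow_mul_pow_eq φ hp hV hξ hpi
  refine ⟨s, hs0, ?_⟩
  haveI : Nonempty V := ⟨⟨_, hξ⟩⟩
  have hW : IsAffineOpen (φ ⁻¹ᵁ V) := isAffineOpen_preimage_of_isAffineHom_morphismRestrict φ hV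
  set t : Γ(Q, φ ⁻¹ᵁ V) := φ.app V s with htdef
  have e : φ ⁻¹ᵁ X.basicOpen s = Q.basicOpen t := φ.preimage_basicOpen s
  have hV' : IsAffineOpen (X.basicOpen s) := hV.basicOpen s
  have hW' : IsAffineOpen (φ ⁻¹ᵁ X.basicOpen s) := by rw [e]; exact hW.basicOpen t
  rw [morphismRestrict_iff_specMap_app φ hV' hW' (P := @UniversallyInjective)]
  -- replace `φ.app (X_s)` by `ψ = φ.appLE (X_s) (Q_t)`, an isomorphic arrow
  have hle : Q.basicOpen t ≤ φ ⁻¹ᵁ X.basicOpen s := e.ge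
  let ψ := φ.appLE (X.basicOpen s) (Q.basicOpen t) hle
  have hψ : φ.app (X.basicOpen s) ≫ Q.presheaf.map (eqToHom e.symm).op = ψ := by
    rw [Scheme.Hom.app_eq_appLE, Scheme.Hom.appLE_map]
  have hiso : IsIso (Q.presheaf.map (eqToHom e.symm).op) := by
    rw [eqToHom_op]; infer_instance
  rw [← MorphismProperty.cancel_left_of_respectsIso @UniversallyInjective
    (Spec.map (Q.presheaf.map (eqToHom e.symm).op)), ← Spec.map_comp, hψ]
  -- characteristic `p` on `Γ(X, X_s)`
  haveI : Nonempty (X.basicOpen s) := by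
    have hne : X.basicOpen s ≠ ⊥ := by rwa [Ne, basicOpen_eq_bot_iff]
    obtain ⟨x, hx⟩ := (TopologicalSpace.Opens.ne_bot_iff_nonempty _).mp hne
    exact ⟨⟨x, hx⟩⟩
  haveI : CharP Γ(X, X.basicOpen s) p :=
    RingHom.charP (X.germToFunctionField (X.basicOpen s)).hom
      (X.germToFunctionField_injective _) p
  refine universallyInjective_SpecMap_of_forall_pow_mem ψ hp fun x => ?_
  -- localizations `A_s = Γ(X, X_s)`, `B_t = Γ(Q, Q_t)`
  haveI := hV.isLocalization_basicOpen s
  haveI := hW.isLocalization_basicOpen t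
  have hψalg : ∀ a : Γ(X, V), ψ (algebraMap Γ(X, V) Γ(X, X.basicOpen s) a) =
      algebraMap Γ(Q, φ ⁻¹ᵁ V) Γ(Q, Q.basicOpen t) (φ.app V a) := by
    intro a
    change (X.presheaf.map (homOfLE (X.basicOpen_le s)).op ≫ ψ) a =
      (φ.app V ≫ Q.presheaf.map (homOfLE (Q.basicOpen_le t)).op) a
    congr 2
    rw [Scheme.Hom.map_appLE, Scheme.Hom.app_eq_appLE, Scheme.Hom.appLE_map]
  obtain ⟨⟨b, ⟨_, k, rfl⟩⟩, hx⟩ := IsLocalization.surj (Submonoid.powers t) x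
  obtain ⟨n, j, a, hb⟩ := hs b
  -- `u = s` is a unit in `A_s`
  have hu : IsUnit (algebraMap Γ(X, V) Γ(X, X.basicOpen s) s) :=
    IsLocalization.Away.algebraMap_isUnit s
  have htψ : algebraMap Γ(Q, φ ⁻¹ᵁ V) Γ(Q, Q.basicOpen t) t =
      ψ (algebraMap Γ(X, V) Γ(X, X.basicOpen s) s) := (hψalg s).symm
  -- `x^{pⁿ} · ψ(u)^{k pⁿ + j} = ψ(a)`
  have key : x ^ p ^ n * ψ (algebraMap Γ(X, V) Γ(X, X.basicOpen s) s) ^ (k * p ^ n + j) =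
      ψ (algebraMap Γ(X, V) Γ(X, X.basicOpen s) a) := by
    rw [← htψ, hψalg, ← hb, map_mul, map_pow, map_pow, pow_add, pow_mul, ← mul_assoc,
      ← mul_pow]
    simp only at hx
    rw [map_pow] at hx
    rw [hx, ← map_pow, ← map_pow, ← map_mul, ← map_mul]
    ring_nf
  refine ⟨n, algebraMap Γ(X, V) Γ(X, X.basicOpen s) a *
    ↑(hu.unit⁻¹ ^ (k * p ^ n + j)), ?_⟩
  rw [map_mul, ← key, mul_assoc, ← map_pow, ← map_mul, Units.val_pow_eq_pow_val,
    ← mul_pow, IsUnit.mul_val_inv, one_pow, map_one, mul_one]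

/-- **Packaged form**: under the same hypotheses there is an open `V' ∋ ξ` inside `V` over which
`φ` is finite and universally injective. [cite: StacksProject, Tag 01S4 (with EGA I 3.5.8)] -/
theorem exists_isFinite_universallyInjective_morphismRestrict {p : ℕ} (hp : p.Prime)
    [CharP X.functionField p] {V : X.Opens} (hV : IsAffineOpen V) (hξ : genericPoint X ∈ V)
    [IsFinite (φ ∣_ V)]
    (hpi : ∀ b : Q.functionField, ∃ (n : ℕ) (c : X.functionField),
      b ^ p ^ n = functionFieldMap φ c) :
    ∃ V' : X.Opens, genericPoint X ∈ V' ∧ V' ≤ V ∧ IsFinite (φ ∣_ V') ∧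
      UniversallyInjective (φ ∣_ V') := by
  obtain ⟨s, hs0, hs⟩ := exists_universallyInjective_morphismRestrict_basicOpen φ hp hV hξ hpi
  refine ⟨X.basicOpen s, ?_, X.basicOpen_le s, ?_, hs⟩
  · have hne : X.basicOpen s ≠ ⊥ := by rwa [Ne, basicOpen_eq_bot_iff]
    have hne' := (TopologicalSpace.Opens.ne_bot_iff_nonempty _).mp hne
    exact ((genericPoint_spec X).mem_open_set_iff (X.basicOpen s).isOpen).mpr
      (by simpa using hne')
  · exact morphismRestrict_of_le φ (X.basicOpen_le s) inferInstance

end Radicial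

end Summit.ResolutionOfSingularities.ResolutionOfSingularities.Theorems

end
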